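import Mathlib
import HarnessLib
import Summits.HubbardSuperconductivity.HubbardSuperconductivity.Theorems.KLProgrammeKLRegimeEngineTowerLevBridge
import Summits.HubbardSuperconductivity.HubbardSuperconductivity.Theorems.KLProgrammeKLRegimeEngineV8E5CarrierDoorInput

/-!
# Route `KLProgramme` — crux K3 ENGINE (stmt-HubbardSuperconductivity-20437 `KLRegimeEngineV17F2`), stub (b) v2, THE LEVELS PACKAGE (ℓ):
# instantiation (I1), «(I1)-LEV-PIN-CREDIT» — the doors' input sum against the levelled carrier WITH THE PIN's OWN PRESCRIPTION KEPT
# (located by p4 g18, 2026-08-28; cure of …TowerLevBridge §1's `E.erase q`; cell gate-hubbard-kl, seat hubbard-kl-k3c2-p3 g12 as SUBSTITUTE typer — E1 may rename or supersede)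

…TowerLevBridge's `doorInput_le_klLevNormOf` bounds the doors' `(E, τ, q)`-prescribed input sum (`q ∈ E`, `E.card = Fc + 1`) by `klLevNormOf` at the prescription
`τ` on `E ∖ {q}` — level count `Fc` — although the sum pins leg `q` at `(y, τ q)`: the pin's label IS known.  Since `sectorLegSum (prescribedTuples ⟨τ on E⟩) … q (τ q) y`
dominates the same double sum (prescribing `q` is redundant inside a leg sum pinned at `q`), the bound holds at the FULL prescription `τ` on `E`, level count `Fc + 1`
(p5's `levelCount_prescribeOn`).  In the graded units of «(I1)-LEV-GRADED-UNITS» this is one half-power of credit per block (UNITS-MAP convention `F = levelCount`):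

* `doorInput_le_klLevNormOf_all` — `ε^m Σ_{σ|_E = τ|_E} Σ_{x q = y} ‖W^{F_J}_σ(T)(x)‖ ≤ klLevNormOf … J (m+1) T ⟨τ on E⟩` (momentum-conserving `T`);
* `doorInput_of_levelBounds_succ` — level bounds `klLevNormOf … Ωe′ ≤ B (levelCount Ωe′)` give the doors' `hB` with `B (Fc + 1)`;
* **`doorInput_klTowerInput_le_klTowerMeasLev_succ`** — tower instance: the block step's `hB` for `𝒱_{dk}` at `F_{dk−1}` with `B m Fc := klTowerMeasLev … d k (2m) (Fc + 1)`.
Nothing about the model is asserted; nothing asserts (ℓ), any stub, K3 or superconductivity.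
References: BGM 2006 §2.8 (2.76)–(2.77) [cite: BenfattoGiulianiMastropietro2006].
-/

noncomputable section

namespace Summit.HubbardSuperconductivity.HubbardSuperconductivity.Theorems.EngineV8

set_option linter.dupNamespace false -- summit = problem name (single-conjunct summit), D-0017

open Classical
open Real Finset Literature.MathematicalPhysics.QuantumLattice Literature.Probability.LatticeModels GrassmannAlgebra
open Literature.MathematicalPhysics.QuantumLattice.FermiRG
open Summit.HubbardSuperconductivity.HubbardSuperconductivity.Theorems.KLRegimeSplit
open Summit.HubbardSuperconductivity.HubbardSuperconductivity.Theorems.KLProgrammeLegKernels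
open Summit.HubbardSuperconductivity.HubbardSuperconductivity.Theorems.DispersionFlow
open Summit.HubbardSuperconductivity.HubbardSuperconductivity.Theorems.KLRegimeWick

variable {L M : ℕ} [NeZero L]

/-- **THE DOORS' INPUT SUM IS DOMINATED BY THE LEVELLED CARRIER AT THE FULL PRESCRIPTION** (momentum-conserving `T`, thin family `F_J`): for `q ∈ E`,
`ε^m Σ_{σ : σ|_E = τ|_E} Σ_{x : x q = y} ‖W^{F_J}_σ(T)(x)‖ ≤ klLevNormOf … J (m+1) T (τ on E)` — the pin's own prescription kept (level count `E.card`). -/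
theorem doorInput_le_klLevNormOf_all {β : ℝ} (hβ : 0 ≤ β) (μ : ℝ) (K : TrigPolyC4v) (J : ℕ) (T : HubbardGrassmann L M)
    (hT : ∀ (m : ℕ) (X : Fin m → HubbardFieldIdx L M), ∑ i, signedMomentum L (X i).2 (X i).1.1.2 ≠ 0 → kernel ℂ T m X = 0)
    {m : ℕ} (E : Finset (Fin (m + 1))) (τ : Fin (m + 1) → SectorLeg (sectorCount J)) {q : Fin (m + 1)} (hq : q ∈ E) (y : SpaceTimeIdx L M) :
    imagTimeWeight β M ^ m *
        ∑ σ ∈ univ.filter (fun σ : Fin (m + 1) → SectorLeg (sectorCount J) => ∀ e ∈ E, σ e = τ e),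
          ∑ x ∈ univ.filter (fun x : Fin (m + 1) → SpaceTimeIdx L M => x q = y),
            ‖sectorisedKernel L M β (klAnisoFamily L M β μ K klE0 J) T (m + 1) σ x‖ ≤
      klLevNormOf L M β μ K J (m + 1) T (fun i => if i ∈ E then some (τ i) else none) := by
  have hε0 : 0 ≤ imagTimeWeight β M := imagTimeWeight_nonneg hβ M
  set F := klAnisoFamily L M β μ K klE0 J with hF
  rw [klLevNormOf, hubbardSectorKernelNorm_def]
  refine le_trans ?_ (sectorLegSum_le_sectorisedKernelNorm (imagTimeWeight β M) _ _ q (τ q) y)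
  rw [sectorLegSum_def, ← mul_sum]
  refine mul_le_mul_of_nonneg_left ?_ (pow_nonneg hε0 m)
  have hsub : (bgmSectorSet L M F (m + 1)).filter (fun σ : Fin (m + 1) → SectorLeg (sectorCount J) => ∀ e ∈ E, σ e = τ e) ⊆
      univ.filter (fun σ : Fin (m + 1) → SectorLeg (sectorCount J) => ∀ e ∈ E, σ e = τ e) :=
    filter_subset_filter _ (subset_univ _)
  rw [← Finset.sum_subset hsub fun σ hσuniv hσnot => ?_]
  · refine sum_le_sum_of_subset_of_nonneg ?_ fun _ _ _ => sum_nonneg fun _ _ => norm_nonneg _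
    intro σ hσ
    simp only [mem_filter, prescribedTuples] at hσ ⊢
    refine ⟨⟨hσ.1, fun i ℓ hℓ => ?_⟩, hσ.2 q hq⟩
    have hℓ' : (if i ∈ E then some (τ i) else none) = some ℓ := Option.mem_def.1 hℓ
    split_ifs at hℓ' with hi
    rw [← Option.some.inj hℓ']
    exact hσ.2 i hi
  · have hP := (mem_filter.1 hσuniv).2
    have hnot : σ ∉ bgmSectorSet L M F (m + 1) := fun h => hσnot (mem_filter.2 ⟨h, hP⟩)
    exact sum_eq_zero fun x _ => by rw [sectorisedKernel_eq_zero_of_not_mem_bgmSectorSet β F T hT hnot x, norm_zero]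

/-- **THE DOORS' `hB` FROM LEVEL BOUNDS, PIN CREDITED**: if every prescription of level `F` has `klLevNormOf … J (m+1) T Ωe′ ≤ B F`, then for every leg set `E ∋ q`
with `E.card = Fc + 1`, prescription `τ` and point `y`: `ε^m Σ_{σ|_E = τ|_E} Σ_{x q = y} ‖W^{F_J}_σ(T)(x)‖ ≤ B (Fc + 1)` (momentum-conserving `T`). -/
theorem doorInput_of_levelBounds_succ {β : ℝ} (hβ : 0 ≤ β) (μ : ℝ) (K : TrigPolyC4v) (J : ℕ) (T : HubbardGrassmann L M)
    (hT : ∀ (m : ℕ) (X : Fin m → HubbardFieldIdx L M), ∑ i, signedMomentum L (X i).2 (X i).1.1.2 ≠ 0 → kernel ℂ T m X = 0)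
    {m : ℕ} (B : ℕ → ℝ)
    (hB : ∀ Ωe' : Fin (m + 1) → Option (SectorLeg (sectorCount J)), klLevNormOf L M β μ K J (m + 1) T Ωe' ≤ B (levelCount Ωe'))
    (Fc : ℕ) (E : Finset (Fin (m + 1))) (τ : Fin (m + 1) → SectorLeg (sectorCount J)) (q : Fin (m + 1)) (hq : q ∈ E)
    (hE : E.card = Fc + 1) (y : SpaceTimeIdx L M) :
    imagTimeWeight β M ^ m *
        ∑ σ ∈ univ.filter (fun σ : Fin (m + 1) → SectorLeg (sectorCount J) => ∀ e ∈ E, σ e = τ e),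
          ∑ x ∈ univ.filter (fun x : Fin (m + 1) → SpaceTimeIdx L M => x q = y),
            ‖sectorisedKernel L M β (klAnisoFamily L M β μ K klE0 J) T (m + 1) σ x‖ ≤ B (Fc + 1) := by
  refine (doorInput_le_klLevNormOf_all hβ μ K J T hT E τ hq y).trans ?_
  have h := hB (fun i => if i ∈ E then some (τ i) else none)
  rwa [levelCount_prescribeOn E τ, hE] at h

/-- **TOWER INSTANCE, PIN CREDITED: the block step's `hB` for the input `𝒱_{dk}` at `F_{dk−1}`** with `B m Fc := klTowerMeasLev L M β U μ K d k (2m) (Fc + 1)`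
(the literal `hB` shape of `blockStep_ordersGe2_lev_le` / `blockStep_firstOrder_lev_le`). -/
theorem doorInput_klTowerInput_le_klTowerMeasLev_succ [NeZero M] {β : ℝ} (hβ : 0 ≤ β) (U μ : ℝ) (K : TrigPolyC4v) (d k : ℕ)
    (m' Fc : ℕ) (E : Finset (Fin (2 * m' + 1 + 1))) (τ : Fin (2 * m' + 1 + 1) → SectorLeg (sectorCount (d * k - 1)))
    (q : Fin (2 * m' + 1 + 1)) (hq : q ∈ E) (hE : E.card = Fc + 1) (y : SpaceTimeIdx L M) :
    imagTimeWeight β M ^ (2 * m' + 1) *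
        ∑ σ ∈ univ.filter (fun σ : Fin (2 * m' + 1 + 1) → SectorLeg (sectorCount (d * k - 1)) => ∀ e ∈ E, σ e = τ e),
          ∑ x ∈ univ.filter (fun x : Fin (2 * m' + 1 + 1) → SpaceTimeIdx L M => x q = y),
            ‖sectorisedKernel L M β (klAnisoFamily L M β μ K klE0 (d * k - 1)) (klTowerInput L M β U μ K d k) (2 * m' + 1 + 1) σ x‖ ≤
      klTowerMeasLev L M β U μ K d k (2 * (m' + 1)) (Fc + 1) := by
  have h2 : 2 * (m' + 1) = 2 * m' + 1 + 1 := by ring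
  rw [h2]
  refine doorInput_of_levelBounds_succ hβ μ K (d * k - 1) (klTowerInput L M β U μ K d k)
    (fun m X hX => klEffectiveAction_momentumConserving β U μ K klE0 (d * k) m X hX)
    (fun Fc => klTowerMeasLev L M β U μ K d k (2 * m' + 1 + 1) Fc) (fun Ωe' => ?_) Fc E τ q hq hE y
  exact klLevNormOf_le_klTowerMeasLev β U μ K d k (2 * m' + 1 + 1) Ωe'

end Summit.HubbardSuperconductivity.HubbardSuperconductivity.Theorems.EngineV8

end
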